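import Literature.Geometry.Kaehler.ComplexTorusKaehlerLieAlgebra
import Literature.LinearAlgebra.Alternating.DerivationExtensionGraded
import Literature.Geometry.Hyperkaehler.KaehlerFormsAdjointRepresentation
import HarnessLib

/-!
# `[e_a, f_b] = −(ab⁻¹)₀ + ¼ Tr(ab⁻¹) h`: the commutators of the Lefschetz `𝔰𝔩₂`-triples of the
# induced complex structures of a hyperkähler torus (Looijenga–Lunts 1997 §4, Lemma (4.2)) —
# Verbitsky's `𝔰𝔬(4,1)` relations `[L_J, Λ_K] = [Λ_J, L_K] = ad I`, pointwise, in all degrees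

Topic `Literature/Geometry/Hyperkaehler`; lane `lit-hodgefound` (Track 2 foundations library), prover seat
`lit-hodgefound-p06`, generation 14, row g14-#5 (FREE-BY-PROPOSAL). The general torus mechanism (§0) lives in
the namespace `Literature.Geometry.Kaehler.ComplexTorus` of rows A1-43/A1-44 (Looijenga–Lunts §3: the spinor
representation `ρ = spinorRepLin E` of `𝔰𝔬(V ⊕ V^*)` on `H•(X, ℂ) = ⊕ₖ ⋀ᵏ V^* ⊗ ℂ = GForm E ℂ`, `ψ₂ = upEnd`,
`ψ₋₂ = lowEnd`, `ψ₀ = psi0`, `e_κ = lefschetzG κ`, `f_κ = lefschetzDualG κ`, `h = countingG E`, `σ̃ = derivExt E σ`);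
the quaternionic part (§1–§3) in `Literature.Geometry.Hyperkaehler.IsLinearHyperkaehler` (the tree's pointwise
hyperkähler datum `IsLinearHyperkaehler g₀ J` on a complex normed space `E`: `I = i•`, `K = IJ`, twistor operators
`λ_x = x₀I + x₁J + x₂K`, Kähler forms `ω_{λ_x} = fundamentalForm g₀ λ_x`, and Verbitsky's `ad T = adAlt T`, whose
graded form on `GForm E ℂ` is `σ̃_T = derivExt E (θ ↦ θ ∘ T)` by `derivExt_precomp_apply` of
`LinearAlgebra/Alternating/DerivationExtensionGraded.lean`). Every declaration is a definition with a body or a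
theorem; no named fact (net debt `0`).

## Sources, verbatim

* E. Looijenga, V. A. Lunts, *A Lie algebra attached to a projective variety*, Invent. Math. 129 (1997) 361–412
  (arXiv alg-geom/9604014), §4 (numbered text: galaxy `pdf:-4867714119441510100` p0031–p0036; held corpus text
  `paper:arxiv-alg-geom_9604014` p0016–p0018). (4.1): "Let `T` be a left `ℍ`-module of finite rank `m ≥ 1`,
  equipped with positive definite real inner product `⟨ , ⟩ : T × T → ℝ` that is `ℍ`-invariant […] Every
  `J ∈ ℍ₀ ∩ ℍ₁` gives `T` the structure of a complex vector space of dimension `2m`. […] `H_J(x,y) := ⟨x,y⟩ −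
  √−1⟨Jx,y⟩` is a `J`-Hermitian form on `V`. Its imaginary part is antisymmetric and thus determines a 2-form
  `κ_J ∈ ∧²V`. Wedging with `κ_J` defines an operator in `∧V[2m]` that we denote by `e_J`. It has the Lefschetz
  property: the corresponding degree `−2` operator `f_J` is characterized by `f_J = ⋆e_J⋆⁻¹`. This makes sense for
  any nonzero element `a ∈ ℍ₀`: `e_a` has the Lefschetz property and `f_a = Nm(a)⁻¹ ⋆ e_a ⋆⁻¹`. It is clear that
  the `f_a`'s commute. We denote the Lie algebra generated by these elements by `𝔤(V)`." **(4.2) Lemma.** "(i)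
  `(𝔤(ℍ), h)` is a Jordan–Lefschetz pair with `𝔤(ℍ)₂` canonically isomorphic to the vector space underlying `ℍ₀`.
  (ii) We have a natural isomorphism `𝔤(ℍ)₀ ≅ ℍ₀ × ℝh`, where `ℍ₀` is regarded as the Lie algebra of `ℍ₁`. The
  given action of `ℍ₁` on `∧•V` integrates the action of this summand. (iii) `(𝔤(ℍ), h)` is isomorphic to the
  orthogonal Lie algebra defined by the form `x₁x₅ + x₂² + x₃² + x₄²` with `h` corresponding to
  `diag(−1, 0, 0, 0, 1)`. (iv) […]. *Proof.* […] Besides the established fact that the `e_a`'s and the `f_a`'s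
  commute among each other, one verifies that **`[e_a, f_b] = −(ab⁻¹)₀ + ¼ Tr(ab⁻¹) h`**, where `h` defines the
  grading and `(ab⁻¹)₀ ∈ ℍ₀` operates on `∧•V` on the right via the `ℍ`-module structure on `V`."
* M. Verbitsky, *Hyperholomorphic sheaves and new examples of hyperkähler manifolds*, alg-geom/9712012, §4.2
  "The action of `𝔰𝔬(5)` on the cohomology of a hyperkähler manifold" (held corpus text `paper:arxiv-alg-geom_9712012`
  p0017 L45–L83), restating Verbitsky 1990 (Funct. Anal. Appl. 24): "Let `M, ℋ` be a hyperkähler manifold, and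
  `𝔞_ℋ` be a Lie algebra generated by `L_R` and `Λ_R` for all induced complex structures `R` over `M`. Then the Lie
  algebra `𝔞_ℋ` is isomorphic to `𝔰𝔬(4,1)`. […] consider an operator `ad R` on cohomology, acting on `(p,q)`-forms
  as a multiplication by `(p−q)√−1`. The operators `ad R` generate a 3-dimensional Lie algebra `𝔤_ℋ`, which is
  isomorphic to `𝔰𝔲(2)`. […] The algebra `𝔞_ℋ` contains `𝔤_ℋ` as a subalgebra, as follows:
  **`[Λ_J, L_K] = [L_J, Λ_K] = ad I` (etc).** The algebra `𝔞_ℋ` is 10-dimensional. It has the following basis: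
  `L_R, Λ_R`, `ad R` (`R = I, J, K`) and the element `H = [L_R, Λ_R]`."

## Dictionary

Looijenga–Lunts' `a, b ∈ ℍ₀` are the twistor operators `λ_x, λ_y` (`x, y ∈ ℝ³`), `κ_a = ω_{λ_x}`,
`e_a = lefschetzG (fundamentalForm g₀ λ_x)`, `f_b = lefschetzDualG (fundamentalForm g₀ λ_y)` (the tree's frame-free
dual Lefschetz operator, Huybrechts Prop. 1.2.26 / Voisin Lemma 6.19), `h = countingG E` (`= k − dim_ℂ E` on
`k`-forms), `Nm(b) = |y|²`. With the quaternion product `λ_y λ_x = −⟨x, y⟩ − λ_{x×y}`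
(`twistorOp_apply_twistorOp_apply`; the tree's transposition convention `[λ_x, λ_y] = 2λ_{x×y}`) one has
`ab⁻¹ = (⟨x, y⟩ − λ_{x×y})/|y|²`, so **`¼Tr(ab⁻¹) = ⟨x,y⟩/|y|²`** (the coefficient of `h`, on the nose: the
tree's `h = countingG` is Looijenga–Lunts' `h`, "multiplication by `−n + l` on `⋀ˡ`") and the pure part
`−(ab⁻¹)₀ = λ_{x×y}/|y|²` acts through the degree-`0` derivation `σ̃_{λ_{x×y}}` (the sign of this identification
depends on the convention for the infinitesimal right `ℍ`-action on `V = Hom(T, ℝ)`, which the source leaves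
implicit; in the TREE's conventions — `ω_λ(v, w) = g₀(λv, w)`, `Λ` = Huybrechts' dual Lefschetz operator,
`ad` = Verbitsky's `(p − q)i` on `(p,q)`-forms, bracket = commutator of endomorphisms — the printed formula is
EXACTLY `⁅L_x, Λ_y⁆ = |y|⁻² (⟨x, y⟩ h + σ̃_{λ_{x×y}})`, `lie_lefschetzG_lefschetzDualG_twistor`, and Verbitsky's
`[L_J, Λ_K] = [Λ_J, L_K] = ad I` come out with exactly these signs; Verbitsky himself normalises
`ω_R = (·, R·)` and `H = n − r` on `r`-forms, so his own table differs from the tree's by convention-dependent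
signs — the relations are recorded here in the tree's conventions).

## What is formalised

* §0 (any complex torus `X = E/Λ`, frame-free): `lie_gradingElement_lowEnd` (`[u, ψ₋₂(P)] = −2ψ₋₂(P)`),
  `lie_gradingElement_psi0`, `lie_upEnd_upEnd`, `lie_lowEnd_lowEnd` (`𝔤_{±2}` abelian), `lie_psi0_upEnd`
  (`[ψ₀(σ), ψ₂(κ)] = ψ₂(ad(σ^*)κ)`), `lie_psi0_lowEnd` (`[ψ₀(σ), ψ₋₂(P)] = ψ₋₂(−σ^*P − Pσ)`), `upEnd_smul`,
  `lowEnd_smul`, `lefschetzG_smul`; **`spinorRepLin_lowEnd_eq_lefschetzDualG`**: `P` skew with `κ♭ ∘ P = 1` ⟹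
  `ρψ₋₂(P) = f_κ` (uniqueness of the `𝔰𝔩₂`-partner, the tree's `eq_lefschetzDualG_of_isSl2Triple`);
  **`lie_lefschetzG_lefschetzDualG_eq_derivExt`**: `[e_κ, f_{κ'}] = σ̃ − ½Tr(σ)·1`, `σ = κ♭ ∘ κ'⁻¹` (the operator
  of Looijenga–Lunts (3.5)); `lie_lefschetzG_lefschetzG` (`[e, e] = 0`), `lie_lefschetzDualG_lefschetzDualG`
  ("It is clear that the `f_a`'s commute" — on a torus ANY two `f`'s commute), `lie_countingG_derivExt`
  (`[h, σ̃] = 0`), `lie_derivExt_lefschetzG` (`[σ̃, e_κ] = e_{ad(σ^*)κ}`).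
* §1 (`IsLinearHyperkaehler g₀ J`): the musical isomorphisms `flatEquiv`, **`sharp`** (`flat_sharp`, `sharp_flat`,
  `apply_sharp_comm`, `sharp_comp_of_skew`); `twistorOp_apply_twistorOp_apply`; `trace_opI`, `trace_J`, `trace_opK`, **`trace_twistorOp`** (`Tr_ℝ λ = 0`); `flat_fundamentalForm_twistor`
  (`ω_λ♭ = g♭λ`); the `2`-vector **`twistorBivector y = ω_{λ_y}⁻¹ = −|y|⁻² λ_y ∘ ♯`** (`twistorBivector_skew`,
  `flat_comp_twistorBivector : ω_y♭ ∘ ω_y⁻¹ = 1`).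
* §2 **`lefschetzDualG_fundamentalForm_twistor_eq`** (`Λ_{ω_{λ_y}} = ρψ₋₂(ω_{λ_y}⁻¹)`, "`f_a = Nm(a)⁻¹⋆e_a⋆⁻¹`" in
  spinor form), `countingG_eq_degOp_sub`, `flat_twistor_comp_twistorBivector` (`ω_x♭ ∘ ω_y⁻¹ = σ_T`,
  `T = |y|⁻²(⟨x,y⟩1 + λ_{x×y})`), and THE FORMULA **`lie_lefschetzG_lefschetzDualG_twistor`** with its degreewise form
  `lie_lefschetzG_lefschetzDualG_twistor_of` (`⁅L_x, Λ_y⁆η = |y|⁻²(⟨x,y⟩(k − dim_ℂ E)η + ad λ_{x×y} η)`).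
* §3 Verbitsky's relations: **`lie_lefschetzG_J_lefschetzDualG_K`** (`[L_J, Λ_K] = ad I`),
  `lie_lefschetzG_K_lefschetzDualG_I` (`= ad J`), `lie_lefschetzG_I_lefschetzDualG_J` (`= ad K`),
  **`lie_lefschetzDualG_J_lefschetzG_K`** (`[Λ_J, L_K] = ad I`), `lie_lefschetzG_lefschetzDualG_twistor_of_orthogonal`
  (`[L_x, Λ_y] = ad λ_{x×y}` for `x ⊥ y`, `|y| = 1`), `lie_lefschetzG_lefschetzDualG_twistor_self` (`[L_y, Λ_y] = h`);
  the remaining brackets of the span of `L_R, Λ_R, ad R, h`: `lie_lefschetzDualG_twistor_twistor` (`[Λ, Λ] = 0`),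
  `lie_derivExt_twistor_lefschetzG_twistor` (`[ad λ_z, L_x] = −2L_{z×x}`, through the tree's
  `adAlt_twistorOp_fundamentalForm_twistorOp`), `lie_derivExt_twistor_twistor` (`[ad λ_x, ad λ_y] = −2 ad λ_{x×y}`),
  `lowEnd_twistorBivector` / **`lefschetzDualG_fundamentalForm_twistor`** (`Λ_{ω_{λ_y}} = |y|⁻² Σᵢ yᵢ Λ_{ω_{eᵢ}}` —
  the `Λ_R` lie in the span of `Λ_I, Λ_J, Λ_K`), `derivExt_precomp_twistor_eq` (`σ̃_λ = ρψ₀(σ_λ)`),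
  `ad_psi0_twistorBivector`, **`lie_derivExt_twistor_lefschetzDualG_twistor`**
  (`[ad λ_z, Λ_y] = −(2|z×y|²/|y|²) Λ_{z×y}`) and `…_of_orthonormal` (`= −2Λ_{z×y}`).

## Scope (what is NOT here)

The statements (i)–(iv) of Lemma (4.2) themselves — the Jordan–Lefschetz property, the abstract isomorphism with
`𝔰𝔬(x₁x₅ + x₂² + x₃² + x₄²) ≅ 𝔰𝔬(4,1)`, the module `M[2m]` — and Verbitsky's "10-dimensional" (linear independence
of the ten operators) are not formalised; (ii) "the action of `ℍ₁` integrates the action of `ℍ₀`" is, degreewise,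
the tree's `IsotropyGroupInvariance.lean`. This file is pointwise (one quaternionic Hermitian space); the
manifold statement (4.4) needs harmonic forms. `lefschetzDualG` is the tree's symplectic (frame-free) dual
Lefschetz operator, identified with Looijenga–Lunts' `ρψ₋₂(κ⁻¹)` by the uniqueness of `𝔰𝔩₂`-partners.

TECHNIQUE NOTE. As in A1-44, generic `map_neg`/`smul_lie` do not fire syntactically on `Module.End ℂ (GForm E ℂ)`
with its `ℝ`-action and on `(E →L[ℝ] ℝ) →ₗ[ℝ] E` (two instance paths to `Module ℝ E`); such steps are done through
`derivExt_smul'`, `congr`/`LinearMap.ext`, or the scalar-central lemma `lie_smul_one`.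

## References

* [LooijengaLunts1997] E. Looijenga, V. A. Lunts, *A Lie algebra attached to a projective variety*, Invent. Math.
  129 (1997) 361–412, §1 (1.1), §3 (3.1)–(3.5), §4 (4.1)–(4.2).
* [Verbitsky1997HyperholomorphicSheaves] M. Verbitsky, *Hyperholomorphic sheaves and new examples of hyperkähler
  manifolds*, alg-geom/9712012, §4.2 (the `𝔰𝔬(5)`/`𝔰𝔬(4,1)` relations, after Verbitsky 1990).
* [Verbitsky1990SO5] M. Verbitsky, *Action of the Lie algebra SO(5) on the cohomology of a hyperkähler manifold*,
  Funct. Anal. Appl. 24 (1990) 229–230 (the original statement; read here through Verbitsky 1997 §4.2).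
* [Verbitsky1996Hyperholomorphic] M. Verbitsky, *Hyperholomorphic bundles over a hyperkähler manifold*, J. Alg.
  Geom. 5 (1996), §1 (`ad I`; the `𝔰𝔲(2)` relations).
* [Huybrechts2005] D. Huybrechts, *Complex Geometry*, Springer (2005), Prop. 1.2.26 (`L`, `Λ`, `H`).
* [Lang2002] S. Lang, *Algebra*, GTM 211 (2002), XIII §3 (trace, transpose).
* [Joyce2007] D. Joyce, *Riemannian Holonomy Groups and Calibrated Geometry*, OUP (2007), §10.1.1 (`I, J, K`).
-/

noncomputable section

open Module Function LieModule Complex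
open Literature.LinearAlgebra.Alternating
open scoped Matrix

-- The commutator Lie ring of the associative endomorphism algebras (as in the A1-43/A1-44 files).
attribute [local instance 100] LieRing.ofAssociativeRing

/-! ## §0 The torus mechanism (any complex torus): `f_κ = ρ(ψ₋₂(κ⁻¹))` frame-free, and
`[e_κ, f_{κ'}] = ρ(ψ₀(κ♭ ∘ κ'⁻¹)) = σ̃ − ½ Tr σ` -/

namespace Literature.Geometry.Kaehler.ComplexTorus

variable {E : Type*} [NormedAddCommGroup E] [NormedSpace ℂ E] [FiniteDimensional ℂ E]

omit [FiniteDimensional ℂ E] in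
/-- The commutator bracket of `𝔤𝔩(V ⊕ V^*)`, pointwise. [folklore] -/
private theorem lie_apply' (A B : Module.End ℝ (sumDual E)) (x : sumDual E) : ⁅A, B⁆ x = A (B x) - B (A x) := rfl

omit [FiniteDimensional ℂ E] in
/-- **`[u, ψ₋₂(P)] = −2 ψ₋₂(P)`**: the maps `P : V^* → V` sit in degree `−2` for the grading element `u`
("`u` … inherits a grading with degrees `−2`, `0` and `2`"). [cite: LooijengaLunts1997, §3 (3.1)–(3.2)] -/
theorem lie_gradingElement_lowEnd (P : (E →L[ℝ] ℝ) →ₗ[ℝ] E) :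
    ⁅gradingElement E, lowEnd P⁆ = (-2 : ℝ) • lowEnd P := by
  refine LinearMap.ext fun x ↦ Prod.ext ?_ ?_
  · simp only [lie_apply', lowEnd_apply, gradingElement_apply, Prod.fst_sub, LinearMap.smul_apply, Prod.smul_fst]
    module
  · simp

omit [FiniteDimensional ℂ E] in
/-- `[u, ψ₀(σ)] = 0`: `𝔤𝔩(V^*)` sits in degree `0`. [cite: LooijengaLunts1997, §3 (3.1)–(3.2)] -/
theorem lie_gradingElement_psi0 [FiniteDimensional ℝ E] (σ : Module.End ℝ (E →L[ℝ] ℝ)) :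
    ⁅gradingElement E, psi0 E σ⁆ = 0 := by
  refine LinearMap.ext fun x ↦ Prod.ext ?_ ?_
  · simp [psi0_apply, gradingElement_apply]
  · simp [psi0_apply, gradingElement_apply]

omit [FiniteDimensional ℂ E] in
/-- `[ψ₂(κ), ψ₂(κ')] = 0`: `𝔤₂` is abelian. [cite: LooijengaLunts1997, §3 (3.1)–(3.2)] -/
theorem lie_upEnd_upEnd [FiniteDimensional ℂ E] (κ κ' : E [⋀^Fin 2]→L[ℝ] ℝ) : ⁅upEnd κ, upEnd κ'⁆ = 0 := by
  refine LinearMap.ext fun x ↦ Prod.ext ?_ ?_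
  · simp [upEnd_apply]
  · simp [upEnd_apply]

omit [FiniteDimensional ℂ E] in
/-- `[ψ₋₂(P), ψ₋₂(P')] = 0`: `𝔤₋₂` is abelian ("It is clear that the `f_a`'s commute").
[cite: LooijengaLunts1997, §3 (3.1)–(3.2), §4 (4.1)] -/
theorem lie_lowEnd_lowEnd (P P' : (E →L[ℝ] ℝ) →ₗ[ℝ] E) : ⁅lowEnd P, lowEnd P'⁆ = 0 := by
  refine LinearMap.ext fun x ↦ Prod.ext ?_ ?_
  · simp [lowEnd_apply]
  · simp [lowEnd_apply]

/-- **`[ψ₀(σ), ψ₂(κ)] = ψ₂(ad(σ^*) κ)`**: the degree-`0` part acts on `𝔤₂ = ⋀² V^*` by the derivation action of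
the transpose (`(ad T κ)(x, v) = κ(Tx, v) + κ(x, Tv)`, the tree's `adAlt`). [cite: LooijengaLunts1997, §3 (3.2)] -/
theorem lie_psi0_upEnd (σ : Module.End ℝ (E →L[ℝ] ℝ)) (κ : E [⋀^Fin 2]→L[ℝ] ℝ) :
    ⁅psi0 E σ, upEnd κ⁆ = upEnd (adAlt (LinearMap.toContinuousLinearMap (dualTranspose E σ)) κ) := by
  refine LinearMap.ext fun x ↦ Prod.ext ?_ ?_
  · simp [psi0_apply, upEnd_apply]
  · refine ContinuousLinearMap.ext fun v ↦ ?_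
    simp only [lie_apply', psi0_apply, upEnd_apply, Prod.snd_sub, map_neg, sub_neg_eq_add, add_apply, flat_apply,
      adAlt_apply_two, LinearMap.coe_toContinuousLinearMap', ← apply_dualTranspose E σ (flat κ x.1) v]
    rw [add_comm]

/-- **`f_κ = ρ(ψ₋₂(κ⁻¹))`, frame-free**: if `P : V^* → V` is skew and inverts the flat map of the real `2`-form
`κ` (`κ♭ ∘ P = 1`), then the spinor representation sends `ψ₋₂(P)` to the dual Lefschetz operator `Λ_κ` of the
torus — since `(e_κ, h, ρψ₋₂(P))` is then an `𝔰𝔩₂`-triple (`[ψ₂(κ), ψ₋₂(P)] = ψ₀(κ♭P) = ψ₀(1) = u`,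
`[u, ψ₋₂(P)] = −2ψ₋₂(P)`) and the `𝔰𝔩₂`-partner of `e_κ` is unique ("This `f` is then unique"; the tree's
`eq_lefschetzDualG_of_isSl2Triple`). [cite: LooijengaLunts1997, §1 (1.1), §3 (3.3)] -/
theorem spinorRepLin_lowEnd_eq_lefschetzDualG [Nontrivial E] {κ : E [⋀^Fin 2]→L[ℝ] ℝ}
    {P : (E →L[ℝ] ℝ) →ₗ[ℝ] E} (hP : ∀ ξ ζ : E →L[ℝ] ℝ, ζ (P ξ) = -ξ (P ζ)) (hκP : flat κ ∘ₗ P = 1) :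
    spinorRepLin E (lowEnd P) = lefschetzDualG κ := by
  have hPso : lowEnd P ∈ so E := (lowEnd_mem_so_iff P).2 hP
  refine eq_lefschetzDualG_of_isSl2Triple (IsSl2Triple.mk countingG_ne_zero ?_ (lie_countingG_lefschetzG κ) ?_)
  · rw [← spinorRepLin_upEnd κ, ← spinorRepLin_lie (upEnd_mem_so κ) hPso, lie_upEnd_lowEnd hP κ, hκP, psi0_one,
      spinorRepLin_gradingElement_eq_countingG]
  · rw [← spinorRepLin_gradingElement_eq_countingG, ← spinorRepLin_lie (gradingElement_mem_so E) hPso,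
      lie_gradingElement_lowEnd, map_smul]
    module

/-- **`[e_κ, ρψ₋₂(P)] = ρψ₀(κ♭ ∘ P) = σ̃ − ½ Tr(σ)·1`**, `σ = κ♭ ∘ P ∈ 𝔤𝔩(V^*)`, for every real `2`-form `κ` and
every skew `P : V^* → V` (`σ̃` = the derivation extension `derivExt`). [cite: LooijengaLunts1997, §3 (3.2), (3.5)] -/
theorem lie_lefschetzG_spinorRepLin_lowEnd (κ : E [⋀^Fin 2]→L[ℝ] ℝ) {P : (E →L[ℝ] ℝ) →ₗ[ℝ] E}
    (hP : ∀ ξ ζ : E →L[ℝ] ℝ, ζ (P ξ) = -ξ (P ζ)) :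
    ⁅lefschetzG κ, spinorRepLin E (lowEnd P)⁆ =
      derivExt E (flat κ ∘ₗ P) -
        ((1 / 2 : ℝ) * LinearMap.trace ℝ (E →L[ℝ] ℝ) (flat κ ∘ₗ P)) • (1 : Module.End ℂ (GForm E ℂ)) := by
  rw [← spinorRepLin_upEnd κ, ← spinorRepLin_lie (upEnd_mem_so κ) ((lowEnd_mem_so_iff P).2 hP),
    lie_upEnd_lowEnd hP κ, spinorRepLin_psi0]

/-- **`[e_κ, f_{κ'}] = σ̃ − ½ Tr(σ)·1` with `σ = κ♭ ∘ κ'⁻¹ ∈ 𝔤𝔩(V^*)`** for a real `2`-form `κ` and a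
non-degenerate real `2`-form `κ'` with (skew) inverse `P' = κ'⁻¹ : V^* → V` — the operator whose restriction
to `V^*` Looijenga–Lunts (3.5) places in `End⁰(X)` ("the restriction of `[e_λ, f_κ] ∈ 𝔤𝔩(⋀•V^*)` to `V^*`").
[cite: LooijengaLunts1997, §3 (3.2), (3.5)] -/
theorem lie_lefschetzG_lefschetzDualG_eq_derivExt [Nontrivial E] (κ κ' : E [⋀^Fin 2]→L[ℝ] ℝ)
    {P' : (E →L[ℝ] ℝ) →ₗ[ℝ] E} (hP' : ∀ ξ ζ : E →L[ℝ] ℝ, ζ (P' ξ) = -ξ (P' ζ)) (hκP' : flat κ' ∘ₗ P' = 1) :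
    ⁅lefschetzG κ, lefschetzDualG κ'⁆ =
      derivExt E (flat κ ∘ₗ P') -
        ((1 / 2 : ℝ) * LinearMap.trace ℝ (E →L[ℝ] ℝ) (flat κ ∘ₗ P')) • (1 : Module.End ℂ (GForm E ℂ)) := by
  rw [← spinorRepLin_lowEnd_eq_lefschetzDualG hP' hκP', lie_lefschetzG_spinorRepLin_lowEnd κ hP']

/-- **`[e_κ, e_{κ'}] = 0`** (wedge products with `2`-forms commute). [cite: LooijengaLunts1997, §3 (3.2)] -/
theorem lie_lefschetzG_lefschetzG (κ κ' : E [⋀^Fin 2]→L[ℝ] ℝ) : ⁅lefschetzG κ, lefschetzG κ'⁆ = 0 := by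
  rw [← spinorRepLin_upEnd κ, ← spinorRepLin_upEnd κ', ← spinorRepLin_lie (upEnd_mem_so κ) (upEnd_mem_so κ'),
    lie_upEnd_upEnd, map_zero]

/-- **`[f_κ, f_{κ'}] = 0` for any two non-degenerate real `2`-forms of a torus** ("It is clear that the `f_a`'s
commute": `𝔰𝔬(V ⊕ V^*)₋₂` is abelian). [cite: LooijengaLunts1997, §4 (4.1)] -/
theorem lie_lefschetzDualG_lefschetzDualG [Nontrivial E] {κ κ' : E [⋀^Fin 2]→L[ℝ] ℝ}
    {P P' : (E →L[ℝ] ℝ) →ₗ[ℝ] E} (hP : ∀ ξ ζ : E →L[ℝ] ℝ, ζ (P ξ) = -ξ (P ζ)) (hκP : flat κ ∘ₗ P = 1)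
    (hP' : ∀ ξ ζ : E →L[ℝ] ℝ, ζ (P' ξ) = -ξ (P' ζ)) (hκP' : flat κ' ∘ₗ P' = 1) :
    ⁅lefschetzDualG κ, lefschetzDualG κ'⁆ = 0 := by
  rw [← spinorRepLin_lowEnd_eq_lefschetzDualG hP hκP, ← spinorRepLin_lowEnd_eq_lefschetzDualG hP' hκP',
    ← spinorRepLin_lie ((lowEnd_mem_so_iff P).2 hP) ((lowEnd_mem_so_iff P').2 hP'), lie_lowEnd_lowEnd, map_zero]

omit [FiniteDimensional ℂ E] in
/-- The scalars `c·1`, `c ∈ ℝ`, are central in `𝔤𝔩(H•(X, ℂ))`. [folklore] -/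
private theorem lie_smul_one (c : ℝ) (B : Module.End ℂ (GForm E ℂ)) : ⁅c • (1 : Module.End ℂ (GForm E ℂ)), B⁆ = 0 := by
  refine LinearMap.ext fun w ↦ ?_
  rw [LieRing.of_associative_ring_bracket, LinearMap.sub_apply, Module.End.mul_apply, Module.End.mul_apply,
    LinearMap.smul_apply, LinearMap.smul_apply, Module.End.one_apply, Module.End.one_apply,
    LinearMap.map_smul_of_tower, sub_self, LinearMap.zero_apply]

omit [FiniteDimensional ℂ E] in
/-- **`[h, σ̃] = 0`**: the derivation extensions preserve degrees. [cite: LooijengaLunts1997, §3 (3.2)] -/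
theorem lie_countingG_derivExt [FiniteDimensional ℝ E] (σ : Module.End ℝ (E →L[ℝ] ℝ)) :
    ⁅countingG E, derivExt E σ⁆ = 0 := by
  refine LinearMap.ext fun w ↦ funext fun m ↦ ?_
  rw [LieRing.of_associative_ring_bracket, LinearMap.sub_apply, Pi.sub_apply, Module.End.mul_apply,
    Module.End.mul_apply, countingG_apply, derivExt_apply_apply, derivExt_apply_apply, countingG_apply,
    adAlt_smul_right, sub_self, LinearMap.zero_apply, Pi.zero_apply]

/-- **`[σ̃, e_κ] = e_{ad(σ^*) κ}`**: the degree-`0` derivations act on the Lefschetz operators through their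
action on `2`-forms. [cite: LooijengaLunts1997, §3 (3.2)] -/
theorem lie_derivExt_lefschetzG (σ : Module.End ℝ (E →L[ℝ] ℝ)) (κ : E [⋀^Fin 2]→L[ℝ] ℝ) :
    ⁅derivExt E σ, lefschetzG κ⁆ = lefschetzG (adAlt (LinearMap.toContinuousLinearMap (dualTranspose E σ)) κ) := by
  have h := spinorRepLin_lie (psi0_mem_so E σ) (upEnd_mem_so κ)
  rw [lie_psi0_upEnd, spinorRepLin_upEnd, spinorRepLin_upEnd, spinorRepLin_psi0, sub_lie, lie_smul_one,
    sub_zero] at h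
  exact h.symm


omit [FiniteDimensional ℂ E] in
/-- `ψ₂(c κ) = c ψ₂(κ)`. [cite: LooijengaLunts1997, §3 (3.1)] -/
theorem upEnd_smul [FiniteDimensional ℂ E] (c : ℝ) (κ : E [⋀^Fin 2]→L[ℝ] ℝ) : upEnd (c • κ) = c • upEnd κ := by
  refine LinearMap.ext fun x ↦ Prod.ext ?_ ?_
  · simp [upEnd_apply]
  · refine ContinuousLinearMap.ext fun v ↦ ?_
    simp [upEnd_apply, flat_apply]

omit [FiniteDimensional ℂ E] in
/-- `ψ₋₂(c P) = c ψ₋₂(P)`. [cite: LooijengaLunts1997, §3 (3.1)] -/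
theorem lowEnd_smul (c : ℝ) (P : (E →L[ℝ] ℝ) →ₗ[ℝ] E) : lowEnd (c • P) = c • lowEnd P := by
  refine LinearMap.ext fun x ↦ Prod.ext ?_ ?_
  · simp [lowEnd_apply]
  · simp [lowEnd_apply]

/-- **`e_{cκ} = c e_κ`** (through `ρψ₂`). [cite: LooijengaLunts1997, §3 (3.2)] -/
theorem lefschetzG_smul (c : ℝ) (κ : E [⋀^Fin 2]→L[ℝ] ℝ) : lefschetzG (c • κ) = c • lefschetzG κ := by
  rw [← spinorRepLin_upEnd, upEnd_smul, map_smul, spinorRepLin_upEnd]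

/-- **`[ψ₀(σ), ψ₋₂(P)] = ψ₋₂(−σ^*P − Pσ)`**: the degree-`0` part acts on `𝔤₋₂ = ⋀² V`.
[cite: LooijengaLunts1997, §3 (3.2)] -/
theorem lie_psi0_lowEnd (σ : Module.End ℝ (E →L[ℝ] ℝ)) (P : (E →L[ℝ] ℝ) →ₗ[ℝ] E) :
    ⁅psi0 E σ, lowEnd P⁆ = lowEnd (-(dualTranspose E σ ∘ₗ P) - P ∘ₗ σ) := by
  refine LinearMap.ext fun x ↦ Prod.ext ?_ ?_
  · simp only [lie_apply', psi0_apply, lowEnd_apply, Prod.fst_sub, LinearMap.sub_apply, LinearMap.neg_apply,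
      LinearMap.comp_apply]
  · simp [psi0_apply, lowEnd_apply]

end Literature.Geometry.Kaehler.ComplexTorus

/-! ## §1 The quaternionic Hermitian space: `♯`, `ω_{λ_y}⁻¹ = −|y|⁻² λ_y ∘ ♯`, `λ_y λ_x = −⟨x,y⟩ − λ_{x×y}`,
`Tr λ = 0` -/

namespace Literature.Geometry.Hyperkaehler

namespace IsLinearHyperkaehler

open Literature.Geometry.Kaehler Literature.Geometry.Kaehler.ComplexTorus

variable {E : Type*} [NormedAddCommGroup E] [NormedSpace ℂ E] [FiniteDimensional ℂ E]
  {g₀ : E →L[ℝ] E →L[ℝ] ℝ} {J : E →L[ℝ] E}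

omit [FiniteDimensional ℂ E] in
/-- A positive definite `g₀` has injective flat map `v ↦ g₀(v, ·)`. [cite: LooijengaLunts1997, §4 (4.1)] -/
theorem flatMap_injective (h : IsLinearHyperkaehler g₀ J) : Function.Injective (g₀ : E → (E →L[ℝ] ℝ)) := by
  intro v w hvw
  by_contra hne
  have hpos := h.pos (v - w) (sub_ne_zero.2 hne)
  have h0 : g₀ (v - w) = 0 := by rw [map_sub, hvw, sub_self]
  rw [h0, _root_.zero_apply] at hpos
  exact lt_irrefl _ hpos

/-- **The musical isomorphism `♭ : V ≃ V^*`, `v ↦ g₀(v, ·)`** of the (positive definite) hyperkähler inner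
product (Looijenga–Lunts' "positive definite real inner product `⟨ , ⟩ : T × T → ℝ`"; finite dimension makes the
injective flat map bijective). [cite: LooijengaLunts1997, §4 (4.1)] -/
def flatEquiv (h : IsLinearHyperkaehler g₀ J) : E ≃ₗ[ℝ] (E →L[ℝ] ℝ) :=
  LinearMap.linearEquivOfInjective ((g₀ : E →L[ℝ] (E →L[ℝ] ℝ)) : E →ₗ[ℝ] (E →L[ℝ] ℝ)) h.flatMap_injective
    (finrank_dual_eq E).symm

/-- `♭ v = g₀(v, ·)`. [cite: LooijengaLunts1997, §4 (4.1)] -/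
@[simp]
theorem flatEquiv_apply (h : IsLinearHyperkaehler g₀ J) (v : E) : h.flatEquiv v = g₀ v := rfl

/-- **The sharp map `♯ = ♭⁻¹ : V^* → V`**: `g₀(♯ξ, ·) = ξ`. [cite: LooijengaLunts1997, §4 (4.1)] -/
def sharp (h : IsLinearHyperkaehler g₀ J) : (E →L[ℝ] ℝ) →ₗ[ℝ] E := h.flatEquiv.symm.toLinearMap

/-- `g₀(♯ξ, ·) = ξ`. [cite: LooijengaLunts1997, §4 (4.1)] -/
@[simp]
theorem flat_sharp (h : IsLinearHyperkaehler g₀ J) (ξ : E →L[ℝ] ℝ) : g₀ (h.sharp ξ) = ξ :=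
  h.flatEquiv.apply_symm_apply ξ

/-- `g₀(♯ξ, w) = ξ(w)`. [cite: LooijengaLunts1997, §4 (4.1)] -/
theorem flat_sharp_apply (h : IsLinearHyperkaehler g₀ J) (ξ : E →L[ℝ] ℝ) (w : E) : g₀ (h.sharp ξ) w = ξ w := by
  rw [flat_sharp]

/-- `♯(g₀(v, ·)) = v`. [cite: LooijengaLunts1997, §4 (4.1)] -/
@[simp]
theorem sharp_flat (h : IsLinearHyperkaehler g₀ J) (v : E) : h.sharp (g₀ v) = v :=
  h.flatEquiv.symm_apply_apply v

/-- `♯` is symmetric: `ζ(♯ξ) = ξ(♯ζ)` (`g₀` is symmetric). [cite: LooijengaLunts1997, §4 (4.1)] -/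
theorem apply_sharp_comm (h : IsLinearHyperkaehler g₀ J) (ξ ζ : E →L[ℝ] ℝ) : ζ (h.sharp ξ) = ξ (h.sharp ζ) := by
  rw [← flat_sharp_apply h ζ (h.sharp ξ), h.symm, flat_sharp_apply]

/-- For a `g₀`-skew operator `A`: `♯(ξ ∘ A) = −A(♯ξ)`. [cite: LooijengaLunts1997, §4 (4.1)] -/
theorem sharp_comp_of_skew (h : IsLinearHyperkaehler g₀ J) {A : E →L[ℝ] E}
    (hA : ∀ v w : E, g₀ (A v) w = -g₀ v (A w)) (ξ : E →L[ℝ] ℝ) : h.sharp (ξ.comp A) = -A (h.sharp ξ) := by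
  apply h.flatMap_injective
  ext w
  rw [flat_sharp, ContinuousLinearMap.comp_apply, map_neg, _root_.neg_apply, hA, neg_neg, flat_sharp_apply]

/-! ### The quaternion relations, operator form -/

omit [FiniteDimensional ℂ E] in
/-- **`λ_y λ_x = −⟨x, y⟩ − λ_{x×y}`** for twistor operators `λ_x = x₀I + x₁J + x₂K` (the quaternion product of
pure quaternions: `ab = −⟨a, b⟩ + a × b`, with the tree's transposition convention `[λ_x, λ_y] = 2λ_{x×y}`).
[cite: LooijengaLunts1997, §4 (4.1)] -/
theorem twistorOp_apply_twistorOp_apply (h : IsLinearHyperkaehler g₀ J) (x y : Fin 3 → ℝ) (v : E) :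
    (y 0 • opI E + y 1 • J + y 2 • opK J) ((x 0 • opI E + x 1 • J + x 2 • opK J) v) =
      -((x 0 * y 0 + x 1 * y 1 + x 2 * y 2) • v) -
        ((x ⨯₃ y) 0 • opI E + (x ⨯₃ y) 1 • J + (x ⨯₃ y) 2 • opK J) v := by
  simp only [cross_apply, Matrix.cons_val_zero, Matrix.cons_val_one, Matrix.cons_val_two, Matrix.head_cons,
    Matrix.tail_cons, add_apply, smul_apply, opI_apply, opK_apply, map_add, map_smul, smul_add, smul_smul,
    I_mul_I, h.J_J, h.J_I, smul_neg, neg_one_smul, neg_neg]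
  module

omit [FiniteDimensional ℂ E] in
/-- An operator anticommuting with a square root of `−1` is traceless (`Tr A = Tr(BAB) = −Tr A`). [folklore] -/
private theorem trace_eq_zero_of_anticommute {A B : E →ₗ[ℝ] E} (hB : B * B = -1) (hAB : A * B = -(B * A)) :
    LinearMap.trace ℝ E A = 0 := by
  have h1 : B * (A * B) = A := by
    rw [← mul_assoc, show B * A = -(A * B) by rw [hAB, neg_neg], neg_mul, mul_assoc, hB, mul_neg_one, neg_neg]
  have h2 : A * B * B = -A := by rw [mul_assoc, hB, mul_neg_one]
  have h3 : LinearMap.trace ℝ E A = -LinearMap.trace ℝ E A := by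
    calc LinearMap.trace ℝ E A = LinearMap.trace ℝ E (B * (A * B)) := by rw [h1]
      _ = LinearMap.trace ℝ E (A * B * B) := LinearMap.trace_mul_comm ℝ B (A * B)
      _ = -LinearMap.trace ℝ E A := by rw [h2, map_neg]
  linarith

omit [FiniteDimensional ℂ E] in
/-- `I² = −1` as real endomorphisms. [cite: Joyce2007, §10.1.1] -/
private theorem opI_mul_opI : ((opI E : E →L[ℝ] E) : E →ₗ[ℝ] E) * ((opI E : E →L[ℝ] E) : E →ₗ[ℝ] E) = -1 := by
  ext v
  simp [smul_smul]

omit [FiniteDimensional ℂ E] in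
/-- `J² = −1` as real endomorphisms. [cite: Joyce2007, §10.1.1] -/
private theorem J_mul_J (h : IsLinearHyperkaehler g₀ J) : ((J : E →ₗ[ℝ] E)) * (J : E →ₗ[ℝ] E) = -1 := by
  ext v
  simp [h.J_J]

omit [FiniteDimensional ℂ E] in
/-- `IJ = −JI`. [cite: Joyce2007, §10.1.1] -/
private theorem opI_mul_J (h : IsLinearHyperkaehler g₀ J) :
    ((opI E : E →L[ℝ] E) : E →ₗ[ℝ] E) * (J : E →ₗ[ℝ] E) = -((J : E →ₗ[ℝ] E) * ((opI E : E →L[ℝ] E) : E →ₗ[ℝ] E)) := by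
  ext v
  simp [h.J_I]

omit [FiniteDimensional ℂ E] in
/-- `KI = −IK`. [cite: Joyce2007, §10.1.1] -/
private theorem opK_mul_opI (h : IsLinearHyperkaehler g₀ J) :
    ((opK J : E →L[ℝ] E) : E →ₗ[ℝ] E) * ((opI E : E →L[ℝ] E) : E →ₗ[ℝ] E) =
      -(((opI E : E →L[ℝ] E) : E →ₗ[ℝ] E) * ((opK J : E →L[ℝ] E) : E →ₗ[ℝ] E)) := by
  ext v
  simp [h.J_I, smul_smul]

omit [FiniteDimensional ℂ E] in
/-- `Tr_ℝ I = 0`. [cite: LooijengaLunts1997, §3 (3.4) ("Tr J = 0")] -/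
theorem trace_opI (h : IsLinearHyperkaehler g₀ J) : LinearMap.trace ℝ E ((opI E : E →L[ℝ] E) : E →ₗ[ℝ] E) = 0 :=
  trace_eq_zero_of_anticommute (J_mul_J h) (opI_mul_J h)

omit [FiniteDimensional ℂ E] in
/-- `Tr_ℝ J = 0`. [cite: LooijengaLunts1997, §4 (4.1)] -/
theorem trace_J (h : IsLinearHyperkaehler g₀ J) : LinearMap.trace ℝ E (J : E →ₗ[ℝ] E) = 0 :=
  trace_eq_zero_of_anticommute opI_mul_opI (by rw [opI_mul_J h, neg_neg])

omit [FiniteDimensional ℂ E] in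
/-- `Tr_ℝ K = 0`. [cite: LooijengaLunts1997, §4 (4.1)] -/
theorem trace_opK (h : IsLinearHyperkaehler g₀ J) : LinearMap.trace ℝ E ((opK J : E →L[ℝ] E) : E →ₗ[ℝ] E) = 0 :=
  trace_eq_zero_of_anticommute opI_mul_opI (opK_mul_opI h)

omit [FiniteDimensional ℂ E] in
/-- **`Tr_ℝ λ_z = 0`** for every twistor operator. [cite: LooijengaLunts1997, §4 (4.1)] -/
theorem trace_twistorOp (h : IsLinearHyperkaehler g₀ J) (z : Fin 3 → ℝ) :
    LinearMap.trace ℝ E ((z 0 • opI E + z 1 • J + z 2 • opK J : E →L[ℝ] E) : E →ₗ[ℝ] E) = 0 := by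
  simp only [ContinuousLinearMap.toLinearMap_add, ContinuousLinearMap.toLinearMap_smul, map_add, map_smul,
    h.trace_opI, h.trace_J, h.trace_opK, smul_zero, add_zero]

/-! ### The `2`-vector `ω_{λ_y}⁻¹` -/

/-- `ω_{λ_y}♭ = g♭ ∘ λ_y`: the flat map of the twistor Kähler form is `v ↦ g₀(λ_y v, ·)`.
[cite: LooijengaLunts1997, §4 (4.1) (κ_J = the imaginary part of H_J)] -/
theorem flat_fundamentalForm_twistor (h : IsLinearHyperkaehler g₀ J) (y : Fin 3 → ℝ) (v : E) :
    flat (fundamentalForm g₀ (y 0 • opI E + y 1 • J + y 2 • opK J)) v = g₀ ((y 0 • opI E + y 1 • J + y 2 • opK J) v) := by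
  ext w
  rw [flat_apply, h.fundamentalForm_twistorOp_apply]

/-- **The `2`-vector `ω_{λ_y}⁻¹ := −|y|⁻² λ_y ∘ ♯ : V^* → V`** inverting the flat map of `ω_{λ_y}` (for `y ≠ 0`;
Looijenga–Lunts' `f_a = Nm(a)⁻¹ ⋆ e_a ⋆⁻¹` is `ρψ₋₂` of this `2`-vector, `lefschetzDualG_fundamentalForm_twistor_eq`).
[cite: LooijengaLunts1997, §4 (4.1)] -/
def twistorBivector (h : IsLinearHyperkaehler g₀ J) (y : Fin 3 → ℝ) : (E →L[ℝ] ℝ) →ₗ[ℝ] E :=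
  (-(y 0 ^ 2 + y 1 ^ 2 + y 2 ^ 2)⁻¹ : ℝ) • (((y 0 • opI E + y 1 • J + y 2 • opK J : E →L[ℝ] E) : E →ₗ[ℝ] E) ∘ₗ h.sharp)

/-- `ω_{λ_y}⁻¹ ξ = −|y|⁻² λ_y(♯ξ)`. [cite: LooijengaLunts1997, §4 (4.1)] -/
theorem twistorBivector_apply (h : IsLinearHyperkaehler g₀ J) (y : Fin 3 → ℝ) (ξ : E →L[ℝ] ℝ) :
    h.twistorBivector y ξ = -((y 0 ^ 2 + y 1 ^ 2 + y 2 ^ 2)⁻¹ • (y 0 • opI E + y 1 • J + y 2 • opK J) (h.sharp ξ)) := by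
  simp [twistorBivector, neg_smul]

/-- `ω_{λ_y}⁻¹` is skew (a `2`-vector): `ζ(Pξ) = −ξ(Pζ)`. [cite: LooijengaLunts1997, §4 (4.1)] -/
theorem twistorBivector_skew (h : IsLinearHyperkaehler g₀ J) (y : Fin 3 → ℝ) (ξ ζ : E →L[ℝ] ℝ) :
    ζ (h.twistorBivector y ξ) = -ξ (h.twistorBivector y ζ) := by
  rw [twistorBivector_apply, twistorBivector_apply, map_neg, map_neg, neg_neg, map_smul, map_smul, smul_eq_mul,
    smul_eq_mul, ← flat_sharp_apply h ζ, h.symm (h.sharp ζ), h.inner_twistor_left, flat_sharp_apply, mul_neg, neg_neg]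

omit [FiniteDimensional ℂ E] in
/-- `|y|² ≠ 0` for `y ≠ 0`. [folklore] -/
private theorem normSq_ne_zero {y : Fin 3 → ℝ} (hy : y ≠ 0) : y 0 ^ 2 + y 1 ^ 2 + y 2 ^ 2 ≠ 0 := by
  intro h0
  apply hy
  have h0' : ∀ i : Fin 3, y i = 0 := by
    intro i
    fin_cases i <;> simp only [Fin.zero_eta, Fin.mk_one, Fin.reduceFinMk] <;> nlinarith [sq_nonneg (y 0), sq_nonneg (y 1), sq_nonneg (y 2)]
  exact funext h0'

/-- **`ω_{λ_y}♭ ∘ ω_{λ_y}⁻¹ = 1`** (`λ_y² = −|y|²`). [cite: LooijengaLunts1997, §4 (4.1)] -/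
theorem flat_comp_twistorBivector (h : IsLinearHyperkaehler g₀ J) {y : Fin 3 → ℝ} (hy : y ≠ 0) :
    flat (fundamentalForm g₀ (y 0 • opI E + y 1 • J + y 2 • opK J)) ∘ₗ h.twistorBivector y = 1 := by
  refine LinearMap.ext fun ξ ↦ ?_
  rw [LinearMap.comp_apply, h.flat_fundamentalForm_twistor, twistorBivector_apply, map_neg, map_smul,
    h.twistor_apply_twistor_apply, smul_neg, neg_neg, smul_smul, inv_mul_cancel₀ (normSq_ne_zero hy), one_smul,
    flat_sharp, Module.End.one_apply]

/-- **`Λ_{ω_{λ_y}} = ρψ₋₂(ω_{λ_y}⁻¹)`** (`y ≠ 0`): the dual Lefschetz operator of the twistor Kähler form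
`ω_{λ_y}` is the spinor image of the `2`-vector `−|y|⁻² λ_y ∘ ♯` (Looijenga–Lunts: "`f_a = Nm(a)⁻¹ ⋆ e_a ⋆⁻¹`").
[cite: LooijengaLunts1997, §4 (4.1)] -/
theorem lefschetzDualG_fundamentalForm_twistor_eq [Nontrivial E] (h : IsLinearHyperkaehler g₀ J) {y : Fin 3 → ℝ}
    (hy : y ≠ 0) :
    lefschetzDualG (fundamentalForm g₀ (y 0 • opI E + y 1 • J + y 2 • opK J)) =
      spinorRepLin E (lowEnd (h.twistorBivector y)) :=
  (spinorRepLin_lowEnd_eq_lefschetzDualG (h.twistorBivector_skew y) (h.flat_comp_twistorBivector hy)).symm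

omit [FiniteDimensional ℂ E] in
/-- `σ_{S+T} = σ_S + σ_T` for the precomposition maps `σ_T = (θ ↦ θ ∘ T)`. [folklore] -/
private theorem coe_precomp_add (S T : E →L[ℝ] E) :
    ((ContinuousLinearMap.precomp ℝ (S + T) : (E →L[ℝ] ℝ) →L[ℝ] (E →L[ℝ] ℝ)) : Module.End ℝ (E →L[ℝ] ℝ)) =
      ((ContinuousLinearMap.precomp ℝ S : (E →L[ℝ] ℝ) →L[ℝ] (E →L[ℝ] ℝ)) : Module.End ℝ (E →L[ℝ] ℝ)) +
        ((ContinuousLinearMap.precomp ℝ T : (E →L[ℝ] ℝ) →L[ℝ] (E →L[ℝ] ℝ)) : Module.End ℝ (E →L[ℝ] ℝ)) := by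
  refine LinearMap.ext fun ξ ↦ ContinuousLinearMap.ext fun v ↦ ?_
  simp [ContinuousLinearMap.precomp_apply]

omit [FiniteDimensional ℂ E] in
/-- `σ_{c T} = c σ_T`. [folklore] -/
private theorem coe_precomp_smul (c : ℝ) (T : E →L[ℝ] E) :
    ((ContinuousLinearMap.precomp ℝ (c • T) : (E →L[ℝ] ℝ) →L[ℝ] (E →L[ℝ] ℝ)) : Module.End ℝ (E →L[ℝ] ℝ)) =
      c • ((ContinuousLinearMap.precomp ℝ T : (E →L[ℝ] ℝ) →L[ℝ] (E →L[ℝ] ℝ)) : Module.End ℝ (E →L[ℝ] ℝ)) := by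
  refine LinearMap.ext fun ξ ↦ ContinuousLinearMap.ext fun v ↦ ?_
  simp [ContinuousLinearMap.precomp_apply]

omit [FiniteDimensional ℂ E] in
/-- `σ_{id} = 1`. [folklore] -/
private theorem coe_precomp_id :
    ((ContinuousLinearMap.precomp ℝ (ContinuousLinearMap.id ℝ E) : (E →L[ℝ] ℝ) →L[ℝ] (E →L[ℝ] ℝ)) :
        Module.End ℝ (E →L[ℝ] ℝ)) = 1 := by
  refine LinearMap.ext fun ξ ↦ ContinuousLinearMap.ext fun v ↦ ?_
  simp [ContinuousLinearMap.precomp_apply]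

/-- **`h = deg − ½ dim_ℝ V`** on `H•(X, ℂ)` (the tree's `countingG` against `degOp`). [cite: LooijengaLunts1997, §3 (3.2)] -/
theorem countingG_eq_degOp_sub : countingG E = degOp E - ((finrank ℝ E : ℝ) / 2) • (1 : Module.End ℂ (GForm E ℂ)) := by
  rw [← spinorRepLin_gradingElement_eq_countingG, spinorRepLin_gradingElement]

/-- **`ω_{λ_x}♭ ∘ ω_{λ_y}⁻¹ = σ_T` with `T = |y|⁻² (⟨x, y⟩·1 + λ_{x×y})`** — the endomorphism `ab⁻¹` of
Looijenga–Lunts' formula, transported to `V`: real part `¼Tr(ab⁻¹) = ⟨x,y⟩/|y|²`, pure part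
`−(ab⁻¹)₀ ↔ λ_{x×y}/|y|²`. [cite: LooijengaLunts1997, §4 (4.2) (proof)] -/
theorem flat_twistor_comp_twistorBivector (h : IsLinearHyperkaehler g₀ J) (x y : Fin 3 → ℝ) :
    flat (fundamentalForm g₀ (x 0 • opI E + x 1 • J + x 2 • opK J)) ∘ₗ h.twistorBivector y =
      ((ContinuousLinearMap.precomp ℝ ((y 0 ^ 2 + y 1 ^ 2 + y 2 ^ 2)⁻¹ •
          ((x 0 * y 0 + x 1 * y 1 + x 2 * y 2) • ContinuousLinearMap.id ℝ E +
            ((x ⨯₃ y) 0 • opI E + (x ⨯₃ y) 1 • J + (x ⨯₃ y) 2 • opK J))) :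
          (E →L[ℝ] ℝ) →L[ℝ] (E →L[ℝ] ℝ)) : Module.End ℝ (E →L[ℝ] ℝ)) := by
  refine LinearMap.ext fun ξ ↦ ContinuousLinearMap.ext fun v ↦ ?_
  rw [LinearMap.comp_apply, h.flat_fundamentalForm_twistor, twistorBivector_apply, map_neg, map_smul, map_neg,
    map_smul, _root_.neg_apply, _root_.smul_apply, smul_eq_mul, h.inner_twistor_left (x 0) (x 1) (x 2),
    h.inner_twistor_left (y 0) (y 1) (y 2), flat_sharp_apply, h.twistorOp_apply_twistorOp_apply x y v]
  simp only [map_sub, map_neg, map_smul, map_add, ContinuousLinearMap.coe_coe, ContinuousLinearMap.precomp_apply,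
    ContinuousLinearMap.comp_apply, _root_.smul_apply, _root_.add_apply, ContinuousLinearMap.id_apply, smul_eq_mul]
  ring

/-- **Looijenga–Lunts (4.2), the key formula `[e_a, f_b] = −(ab⁻¹)₀ + ¼ Tr(ab⁻¹) h`, on the forms carrier of a
hyperkähler torus, in the tree's parameters**: for `x, y ∈ ℝ³`, `y ≠ 0`, with `λ_x = x₀I + x₁J + x₂K`,
`L_x = e_{ω_{λ_x}}` (wedge with the Kähler form of `λ_x`), `Λ_y = f_{ω_{λ_y}}`,
`⁅L_x, Λ_y⁆ = |y|⁻² (⟨x, y⟩ · h + σ̃_{λ_{x×y}})`, where `h = countingG` (multiplication by `k − dim_ℂ E` on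
`k`-forms) and `σ̃_T = derivExt(θ ↦ θ ∘ T)` is the derivation extension, i.e. Verbitsky's `ad T` degreewise
(`lie_lefschetzG_lefschetzDualG_twistor_of`). For `a = λ_x`, `b = λ_y` pure quaternions:
`ab⁻¹ = (⟨x,y⟩ − λ_{x×y})/|y|²`, so `¼Tr(ab⁻¹) = ⟨x,y⟩/|y|²` and `−(ab⁻¹)₀ = λ_{x×y}/|y|²`.
[cite: LooijengaLunts1997, §4 (4.2) (proof: "one verifies that [e_a, f_b] = −(ab⁻¹)₀ + ¼Tr(ab⁻¹)h")]
[cite: Verbitsky1997HyperholomorphicSheaves, §4.2 ("[Λ_J, L_K] = [L_J, Λ_K] = ad I (etc)", "H = [L_R, Λ_R]")] -/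
theorem lie_lefschetzG_lefschetzDualG_twistor [Nontrivial E] (h : IsLinearHyperkaehler g₀ J) (x y : Fin 3 → ℝ)
    (hy : y ≠ 0) :
    ⁅lefschetzG (fundamentalForm g₀ (x 0 • opI E + x 1 • J + x 2 • opK J)),
        lefschetzDualG (fundamentalForm g₀ (y 0 • opI E + y 1 • J + y 2 • opK J))⁆ =
      (y 0 ^ 2 + y 1 ^ 2 + y 2 ^ 2)⁻¹ •
        ((x 0 * y 0 + x 1 * y 1 + x 2 * y 2) • countingG E +
          derivExt E ((ContinuousLinearMap.precomp ℝ ((x ⨯₃ y) 0 • opI E + (x ⨯₃ y) 1 • J + (x ⨯₃ y) 2 • opK J) :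
            (E →L[ℝ] ℝ) →L[ℝ] (E →L[ℝ] ℝ)) : Module.End ℝ (E →L[ℝ] ℝ))) := by
  rw [lie_lefschetzG_lefschetzDualG_eq_derivExt _ _ (h.twistorBivector_skew y) (h.flat_comp_twistorBivector hy),
    h.flat_twistor_comp_twistorBivector x y, trace_precomp, coe_precomp_smul, coe_precomp_add, coe_precomp_smul,
    coe_precomp_id, derivExt_smul', derivExt_add', derivExt_smul', derivExt_one, countingG_eq_degOp_sub]
  simp only [ContinuousLinearMap.toLinearMap_smul, ContinuousLinearMap.toLinearMap_add, map_smul, map_add,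
    ContinuousLinearMap.coe_id, LinearMap.trace_id, h.trace_opI, h.trace_J, h.trace_opK, smul_eq_mul]
  module

/-- **The formula on `k`-forms**: `⁅L_x, Λ_y⁆ η = |y|⁻² (⟨x, y⟩ (k − dim_ℂ E) η + ad λ_{x×y} η)` for a complex
`k`-covector `η` (`h = k − n` on `k`-forms, `σ̃_T = ad T` degreewise). [cite: LooijengaLunts1997, §4 (4.2) (proof)]
[cite: Verbitsky1997HyperholomorphicSheaves, §4.2] -/
theorem lie_lefschetzG_lefschetzDualG_twistor_of [Nontrivial E] (h : IsLinearHyperkaehler g₀ J) (x y : Fin 3 → ℝ)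
    (hy : y ≠ 0) (k : ℕ) (η : E [⋀^Fin k]→L[ℝ] ℂ) :
    ⁅lefschetzG (fundamentalForm g₀ (x 0 • opI E + x 1 • J + x 2 • opK J)),
        lefschetzDualG (fundamentalForm g₀ (y 0 • opI E + y 1 • J + y 2 • opK J))⁆ (GForm.of k η) =
      (y 0 ^ 2 + y 1 ^ 2 + y 2 ^ 2)⁻¹ •
        ((x 0 * y 0 + x 1 * y 1 + x 2 * y 2) • (((k : ℂ) - (finrank ℂ E : ℂ)) • GForm.of k η) +
          GForm.of k (adAlt ((x ⨯₃ y) 0 • opI E + (x ⨯₃ y) 1 • J + (x ⨯₃ y) 2 • opK J) η)) := by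
  rw [h.lie_lefschetzG_lefschetzDualG_twistor x y hy, LinearMap.smul_apply, LinearMap.add_apply, LinearMap.smul_apply,
    countingG_of, derivExt_precomp_of]

/-! ### Verbitsky's relations `[L_J, Λ_K] = [Λ_J, L_K] = ad I` (etc.) -/

omit [FiniteDimensional ℂ E] in
/-- `λ_{(1,0,0)} = I`. [folklore] -/
private theorem twistor_e₀ : ((![1, 0, 0] : Fin 3 → ℝ) 0 • opI E + (![1, 0, 0] : Fin 3 → ℝ) 1 • J +
    (![1, 0, 0] : Fin 3 → ℝ) 2 • opK J) = opI E := by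
  simp

omit [FiniteDimensional ℂ E] in
/-- `λ_{(0,1,0)} = J`. [folklore] -/
private theorem twistor_e₁ : ((![0, 1, 0] : Fin 3 → ℝ) 0 • opI E + (![0, 1, 0] : Fin 3 → ℝ) 1 • J +
    (![0, 1, 0] : Fin 3 → ℝ) 2 • opK J) = J := by
  simp

omit [FiniteDimensional ℂ E] in
/-- `λ_{(0,0,1)} = K`. [folklore] -/
private theorem twistor_e₂ : ((![0, 0, 1] : Fin 3 → ℝ) 0 • opI E + (![0, 0, 1] : Fin 3 → ℝ) 1 • J +
    (![0, 0, 1] : Fin 3 → ℝ) 2 • opK J) = opK J := by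
  simp

omit [FiniteDimensional ℂ E] in
/-- `λ_{(−1,0,0)} = −I`. [folklore] -/
private theorem twistor_neg_e₀ : ((![-1, 0, 0] : Fin 3 → ℝ) 0 • opI E + (![-1, 0, 0] : Fin 3 → ℝ) 1 • J +
    (![-1, 0, 0] : Fin 3 → ℝ) 2 • opK J) = (-1 : ℝ) • opI E := by
  simp

omit [FiniteDimensional ℂ E] in
/-- `λ_0 = 0`. [folklore] -/
private theorem twistor_zero : ((0 : Fin 3 → ℝ) 0 • opI E + (0 : Fin 3 → ℝ) 1 • J + (0 : Fin 3 → ℝ) 2 • opK J) = 0 := by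
  simp

omit [FiniteDimensional ℂ E] in
/-- `σ_0 = 0`. [folklore] -/
private theorem coe_precomp_zero :
    ((ContinuousLinearMap.precomp ℝ (0 : E →L[ℝ] E) : (E →L[ℝ] ℝ) →L[ℝ] (E →L[ℝ] ℝ)) : Module.End ℝ (E →L[ℝ] ℝ)) = 0 := by
  refine LinearMap.ext fun ξ ↦ ContinuousLinearMap.ext fun v ↦ ?_
  simp [ContinuousLinearMap.precomp_apply]

/-- `e₁ × e₂ = e₀`. [folklore] -/
private theorem cross_e₁_e₂ : (![0, 1, 0] : Fin 3 → ℝ) ⨯₃ ![0, 0, 1] = ![1, 0, 0] := by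
  ext i; fin_cases i <;> simp [cross_apply]

/-- `e₂ × e₀ = e₁`. [folklore] -/
private theorem cross_e₂_e₀ : (![0, 0, 1] : Fin 3 → ℝ) ⨯₃ ![1, 0, 0] = ![0, 1, 0] := by
  ext i; fin_cases i <;> simp [cross_apply]

/-- `e₀ × e₁ = e₂`. [folklore] -/
private theorem cross_e₀_e₁ : (![1, 0, 0] : Fin 3 → ℝ) ⨯₃ ![0, 1, 0] = ![0, 0, 1] := by
  ext i; fin_cases i <;> simp [cross_apply]

/-- `e₂ × e₁ = −e₀`. [folklore] -/
private theorem cross_e₂_e₁ : (![0, 0, 1] : Fin 3 → ℝ) ⨯₃ ![0, 1, 0] = ![-1, 0, 0] := by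
  ext i; fin_cases i <;> simp [cross_apply]

/-- `e₀ ≠ 0`. [folklore] -/
private theorem e₀_ne_zero : (![1, 0, 0] : Fin 3 → ℝ) ≠ 0 := fun h0 ↦ by simpa using congrFun h0 0
/-- `e₁ ≠ 0`. [folklore] -/
private theorem e₁_ne_zero : (![0, 1, 0] : Fin 3 → ℝ) ≠ 0 := fun h0 ↦ by simpa using congrFun h0 1
/-- `e₂ ≠ 0`. [folklore] -/
private theorem e₂_ne_zero : (![0, 0, 1] : Fin 3 → ℝ) ≠ 0 := fun h0 ↦ by simpa using congrFun h0 2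

/-- **Verbitsky: `[L_J, Λ_K] = ad I`** (all degrees at once: `σ̃_I` is `ad I` on each `⋀^k`).
[cite: Verbitsky1997HyperholomorphicSheaves, §4.2 ("[Λ_J, L_K] = [L_J, Λ_K] = ad I")]
[cite: LooijengaLunts1997, §4 (4.2)] -/
theorem lie_lefschetzG_J_lefschetzDualG_K [Nontrivial E] (h : IsLinearHyperkaehler g₀ J) :
    ⁅lefschetzG (fundamentalForm g₀ J), lefschetzDualG (fundamentalForm g₀ (opK J))⁆ =
      derivExt E ((ContinuousLinearMap.precomp ℝ (opI E) : (E →L[ℝ] ℝ) →L[ℝ] (E →L[ℝ] ℝ)) :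
        Module.End ℝ (E →L[ℝ] ℝ)) := by
  have e := h.lie_lefschetzG_lefschetzDualG_twistor ![0, 1, 0] ![0, 0, 1] e₂_ne_zero
  rw [cross_e₁_e₂, twistor_e₁, twistor_e₂, twistor_e₀] at e
  rw [e]
  simp

/-- **Verbitsky: `[L_K, Λ_I] = ad J`.** [cite: Verbitsky1997HyperholomorphicSheaves, §4.2 ("(etc)")]
[cite: LooijengaLunts1997, §4 (4.2)] -/
theorem lie_lefschetzG_K_lefschetzDualG_I [Nontrivial E] (h : IsLinearHyperkaehler g₀ J) :
    ⁅lefschetzG (fundamentalForm g₀ (opK J)), lefschetzDualG (fundamentalForm g₀ (opI E))⁆ =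
      derivExt E ((ContinuousLinearMap.precomp ℝ J : (E →L[ℝ] ℝ) →L[ℝ] (E →L[ℝ] ℝ)) : Module.End ℝ (E →L[ℝ] ℝ)) := by
  have e := h.lie_lefschetzG_lefschetzDualG_twistor ![0, 0, 1] ![1, 0, 0] e₀_ne_zero
  rw [cross_e₂_e₀, twistor_e₂, twistor_e₀, twistor_e₁] at e
  rw [e]
  simp

/-- **Verbitsky: `[L_I, Λ_J] = ad K`.** [cite: Verbitsky1997HyperholomorphicSheaves, §4.2 ("(etc)")]
[cite: LooijengaLunts1997, §4 (4.2)] -/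
theorem lie_lefschetzG_I_lefschetzDualG_J [Nontrivial E] (h : IsLinearHyperkaehler g₀ J) :
    ⁅lefschetzG (fundamentalForm g₀ (opI E)), lefschetzDualG (fundamentalForm g₀ J)⁆ =
      derivExt E ((ContinuousLinearMap.precomp ℝ (opK J) : (E →L[ℝ] ℝ) →L[ℝ] (E →L[ℝ] ℝ)) :
        Module.End ℝ (E →L[ℝ] ℝ)) := by
  have e := h.lie_lefschetzG_lefschetzDualG_twistor ![1, 0, 0] ![0, 1, 0] e₁_ne_zero
  rw [cross_e₀_e₁, twistor_e₀, twistor_e₁, twistor_e₂] at e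
  rw [e]
  simp

/-- **Verbitsky: `[Λ_J, L_K] = ad I`** as well (`= −[L_K, Λ_J] = −ad(K×J) = −ad(−I)`).
[cite: Verbitsky1997HyperholomorphicSheaves, §4.2 ("[Λ_J, L_K] = [L_J, Λ_K] = ad I")] -/
theorem lie_lefschetzDualG_J_lefschetzG_K [Nontrivial E] (h : IsLinearHyperkaehler g₀ J) :
    ⁅lefschetzDualG (fundamentalForm g₀ J), lefschetzG (fundamentalForm g₀ (opK J))⁆ =
      derivExt E ((ContinuousLinearMap.precomp ℝ (opI E) : (E →L[ℝ] ℝ) →L[ℝ] (E →L[ℝ] ℝ)) :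
        Module.End ℝ (E →L[ℝ] ℝ)) := by
  have e := h.lie_lefschetzG_lefschetzDualG_twistor ![0, 0, 1] ![0, 1, 0] e₁_ne_zero
  rw [cross_e₂_e₁, twistor_e₂, twistor_e₁, twistor_neg_e₀, coe_precomp_smul, derivExt_smul'] at e
  rw [← lie_skew, e]
  simp
  module

/-- **`[L_x, Λ_y] = ad λ_{x×y}` for orthogonal `x ⊥ y` with `|y| = 1`** (the off-diagonal relations of
Verbitsky's `𝔰𝔬(4,1)` in invariant form). [cite: Verbitsky1997HyperholomorphicSheaves, §4.2]
[cite: LooijengaLunts1997, §4 (4.2)] -/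
theorem lie_lefschetzG_lefschetzDualG_twistor_of_orthogonal [Nontrivial E] (h : IsLinearHyperkaehler g₀ J)
    {x y : Fin 3 → ℝ} (hy : y 0 ^ 2 + y 1 ^ 2 + y 2 ^ 2 = 1) (hxy : x 0 * y 0 + x 1 * y 1 + x 2 * y 2 = 0) :
    ⁅lefschetzG (fundamentalForm g₀ (x 0 • opI E + x 1 • J + x 2 • opK J)),
        lefschetzDualG (fundamentalForm g₀ (y 0 • opI E + y 1 • J + y 2 • opK J))⁆ =
      derivExt E ((ContinuousLinearMap.precomp ℝ ((x ⨯₃ y) 0 • opI E + (x ⨯₃ y) 1 • J + (x ⨯₃ y) 2 • opK J) :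
        (E →L[ℝ] ℝ) →L[ℝ] (E →L[ℝ] ℝ)) : Module.End ℝ (E →L[ℝ] ℝ)) := by
  have hy0 : y ≠ 0 := by
    rintro rfl
    simp at hy
  rw [h.lie_lefschetzG_lefschetzDualG_twistor x y hy0, hy, hxy, inv_one, one_smul, zero_smul, zero_add]

/-- **`[L_y, Λ_y] = h` recovered** (`x = y`, `|y| = 1`: `⟨y, y⟩ = 1`, `y × y = 0`) — consistent with the tree's
`lie_lefschetzG_lefschetzDualG`. [cite: Verbitsky1997HyperholomorphicSheaves, §4.2 ("H = [L_R, Λ_R]")] -/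
theorem lie_lefschetzG_lefschetzDualG_twistor_self [Nontrivial E] (h : IsLinearHyperkaehler g₀ J) {y : Fin 3 → ℝ}
    (hy : y 0 ^ 2 + y 1 ^ 2 + y 2 ^ 2 = 1) :
    ⁅lefschetzG (fundamentalForm g₀ (y 0 • opI E + y 1 • J + y 2 • opK J)),
        lefschetzDualG (fundamentalForm g₀ (y 0 • opI E + y 1 • J + y 2 • opK J))⁆ = countingG E := by
  have hy0 : y ≠ 0 := by
    rintro rfl
    simp at hy
  have hyy : y 0 * y 0 + y 1 * y 1 + y 2 * y 2 = 1 := by nlinarith [hy]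
  have hc : y ⨯₃ y = 0 := cross_self y
  rw [h.lie_lefschetzG_lefschetzDualG_twistor y y hy0, hy, hyy, inv_one, one_smul, one_smul, hc, twistor_zero,
    coe_precomp_zero, (derivExt E).map_zero, add_zero]

/-! ### The rest of the multiplication table of `span{L_R, Λ_R, ad R, H}` -/

/-- **`[Λ_x, Λ_y] = 0`** for the twistor Kähler forms ("It is clear that the `f_a`'s commute").
[cite: LooijengaLunts1997, §4 (4.1)] -/
theorem lie_lefschetzDualG_twistor_twistor [Nontrivial E] (h : IsLinearHyperkaehler g₀ J) {x y : Fin 3 → ℝ}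
    (hx : x ≠ 0) (hy : y ≠ 0) :
    ⁅lefschetzDualG (fundamentalForm g₀ (x 0 • opI E + x 1 • J + x 2 • opK J)),
        lefschetzDualG (fundamentalForm g₀ (y 0 • opI E + y 1 • J + y 2 • opK J))⁆ = 0 :=
  lie_lefschetzDualG_lefschetzDualG (h.twistorBivector_skew x) (h.flat_comp_twistorBivector hx)
    (h.twistorBivector_skew y) (h.flat_comp_twistorBivector hy)

/-- **`[ad λ_z, L_x] = −2 L_{z×x}`** (`ad` is a derivation: `[σ̃_T, e_κ] = e_{ad T κ}`, and
`ad λ_z ω_{λ_x} = −2 ω_{λ_{z×x}}`). [cite: Verbitsky1997HyperholomorphicSheaves, §4.2]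
[cite: LooijengaLunts1997, §4 (4.2) ("e_a and f_a commute with the action of ℍ" up to this rotation)] -/
theorem lie_derivExt_twistor_lefschetzG_twistor (h : IsLinearHyperkaehler g₀ J) (z x : Fin 3 → ℝ) :
    ⁅derivExt E ((ContinuousLinearMap.precomp ℝ (z 0 • opI E + z 1 • J + z 2 • opK J) :
        (E →L[ℝ] ℝ) →L[ℝ] (E →L[ℝ] ℝ)) : Module.End ℝ (E →L[ℝ] ℝ)),
        lefschetzG (fundamentalForm g₀ (x 0 • opI E + x 1 • J + x 2 • opK J))⁆ =
      (-2 : ℝ) • lefschetzG (fundamentalForm g₀ ((z ⨯₃ x) 0 • opI E + (z ⨯₃ x) 1 • J + (z ⨯₃ x) 2 • opK J)) := by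
  rw [lie_derivExt_lefschetzG, dualTranspose_precomp, h.adAlt_twistorOp_fundamentalForm_twistorOp z x, lefschetzG_smul]

omit [FiniteDimensional ℂ E] in
/-- **`[ad λ_x, ad λ_y] = −2 ad λ_{x×y}`** on the whole of `H•(X, ℂ)` (degreewise the tree's
`adAlt_twistorOp_commutator`). [cite: Verbitsky1997HyperholomorphicSheaves, §4.2 ("ad R generate … 𝔰𝔲(2)")] -/
theorem lie_derivExt_twistor_twistor [FiniteDimensional ℝ E] (h : IsLinearHyperkaehler g₀ J) (x y : Fin 3 → ℝ) :
    ⁅derivExt E ((ContinuousLinearMap.precomp ℝ (x 0 • opI E + x 1 • J + x 2 • opK J) :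
        (E →L[ℝ] ℝ) →L[ℝ] (E →L[ℝ] ℝ)) : Module.End ℝ (E →L[ℝ] ℝ)),
      derivExt E ((ContinuousLinearMap.precomp ℝ (y 0 • opI E + y 1 • J + y 2 • opK J) :
        (E →L[ℝ] ℝ) →L[ℝ] (E →L[ℝ] ℝ)) : Module.End ℝ (E →L[ℝ] ℝ))⁆ =
      -((2 : ℝ) • derivExt E ((ContinuousLinearMap.precomp ℝ ((x ⨯₃ y) 0 • opI E + (x ⨯₃ y) 1 • J + (x ⨯₃ y) 2 • opK J) :
        (E →L[ℝ] ℝ) →L[ℝ] (E →L[ℝ] ℝ)) : Module.End ℝ (E →L[ℝ] ℝ))) := by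
  refine LinearMap.ext fun w ↦ funext fun m ↦ ?_
  rw [LieRing.of_associative_ring_bracket, LinearMap.sub_apply, Pi.sub_apply, Module.End.mul_apply,
    Module.End.mul_apply, derivExt_precomp_apply, derivExt_precomp_apply, derivExt_precomp_apply,
    derivExt_precomp_apply, LinearMap.neg_apply, Pi.neg_apply, LinearMap.smul_apply, Pi.smul_apply,
    derivExt_precomp_apply, h.adAlt_twistorOp_commutator x y (w m)]

/-- The `2`-vectors of the twistor forms depend linearly on the parameter up to the norm factor:
`ψ₋₂(ω_{λ_y}⁻¹) = |y|⁻² Σᵢ yᵢ ψ₋₂(ω_{eᵢ}⁻¹)`. [cite: LooijengaLunts1997, §4 (4.1) ("f_a = Nm(a)⁻¹ ⋆ e_a ⋆⁻¹")] -/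
theorem lowEnd_twistorBivector (h : IsLinearHyperkaehler g₀ J) (y : Fin 3 → ℝ) :
    lowEnd (h.twistorBivector y) =
      (y 0 ^ 2 + y 1 ^ 2 + y 2 ^ 2)⁻¹ •
        (y 0 • lowEnd (h.twistorBivector ![1, 0, 0]) + y 1 • lowEnd (h.twistorBivector ![0, 1, 0]) +
          y 2 • lowEnd (h.twistorBivector ![0, 0, 1])) := by
  refine LinearMap.ext fun x ↦ Prod.ext ?_ ?_
  · simp only [lowEnd_apply, twistorBivector_apply, LinearMap.smul_apply, LinearMap.add_apply, Prod.smul_fst,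
      Prod.fst_add, add_apply, smul_apply, opI_apply, opK_apply, Matrix.cons_val_zero, Matrix.cons_val_one,
      Matrix.cons_val_two, Matrix.head_cons, Matrix.tail_cons, smul_add, smul_neg, neg_add, smul_smul]
    norm_num
  · simp [lowEnd_apply]

/-- **`Λ_{ω_{λ_y}} = |y|⁻² (y₀ Λ_{ω_I} + y₁ Λ_{ω_J} + y₂ Λ_{ω_K})`** (`y ≠ 0`): on the characteristic `3`-plane the
dual Lefschetz operators of the UNIT twistor forms depend linearly on the parameter (Looijenga–Lunts:
"`f_a = Nm(a)⁻¹ ⋆ e_a ⋆⁻¹`"; Verbitsky: the `Λ_R` lie in the span of `Λ_I, Λ_J, Λ_K`).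
[cite: LooijengaLunts1997, §4 (4.1)] [cite: Verbitsky1997HyperholomorphicSheaves, §4.2 ("basis: L_R, Λ_R, ad R … and H")] -/
theorem lefschetzDualG_fundamentalForm_twistor [Nontrivial E] (h : IsLinearHyperkaehler g₀ J) {y : Fin 3 → ℝ}
    (hy : y ≠ 0) :
    lefschetzDualG (fundamentalForm g₀ (y 0 • opI E + y 1 • J + y 2 • opK J)) =
      (y 0 ^ 2 + y 1 ^ 2 + y 2 ^ 2)⁻¹ •
        (y 0 • lefschetzDualG (fundamentalForm g₀ (opI E)) + y 1 • lefschetzDualG (fundamentalForm g₀ J) +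
          y 2 • lefschetzDualG (fundamentalForm g₀ (opK J))) := by
  have hI := h.lefschetzDualG_fundamentalForm_twistor_eq e₀_ne_zero
  have hJ := h.lefschetzDualG_fundamentalForm_twistor_eq e₁_ne_zero
  have hK := h.lefschetzDualG_fundamentalForm_twistor_eq e₂_ne_zero
  rw [twistor_e₀] at hI
  rw [twistor_e₁] at hJ
  rw [twistor_e₂] at hK
  rw [h.lefschetzDualG_fundamentalForm_twistor_eq hy, lowEnd_twistorBivector, map_smul, map_add, map_add, map_smul,
    map_smul, map_smul, hI, hJ, hK]

/-! ### `[ad λ_z, Λ_y]` -/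

/-- **`σ̃_{λ_z} = ρψ₀(σ_{λ_z})`**: for the (traceless) twistor operators the derivation extension is exactly the
spinor image of `ψ₀` (no scalar shift). [cite: LooijengaLunts1997, §3 (3.2), §4 (4.2)] -/
theorem derivExt_precomp_twistor_eq (h : IsLinearHyperkaehler g₀ J) (z : Fin 3 → ℝ) :
    derivExt E ((ContinuousLinearMap.precomp ℝ (z 0 • opI E + z 1 • J + z 2 • opK J) :
        (E →L[ℝ] ℝ) →L[ℝ] (E →L[ℝ] ℝ)) : Module.End ℝ (E →L[ℝ] ℝ)) =
      spinorRepLin E (psi0 E ((ContinuousLinearMap.precomp ℝ (z 0 • opI E + z 1 • J + z 2 • opK J) :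
        (E →L[ℝ] ℝ) →L[ℝ] (E →L[ℝ] ℝ)) : Module.End ℝ (E →L[ℝ] ℝ))) := by
  rw [spinorRepLin_psi0, trace_precomp, h.trace_twistorOp, mul_zero, zero_smul, sub_zero]

omit [FiniteDimensional ℂ E] in
/-- The transpose of `σ_T` is `T` (linear-map form of the tree's `dualTranspose_precomp`). [cite: Lang2002, XIII §3] -/
private theorem dualTranspose_precomp' [FiniteDimensional ℝ E] (T : E →L[ℝ] E) :
    dualTranspose E ((ContinuousLinearMap.precomp ℝ T : (E →L[ℝ] ℝ) →L[ℝ] (E →L[ℝ] ℝ)) : Module.End ℝ (E →L[ℝ] ℝ)) =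
      (T : E →ₗ[ℝ] E) := by
  have e := congrArg (fun f : E →L[ℝ] E ↦ (f : E →ₗ[ℝ] E)) (dualTranspose_precomp E T)
  simpa using e

omit [FiniteDimensional ℂ E] in
/-- Lagrange's identity `|z × y|² = |z|²|y|² − ⟨z, y⟩²`. [folklore] -/
private theorem normSq_cross (z y : Fin 3 → ℝ) :
    (z ⨯₃ y) 0 ^ 2 + (z ⨯₃ y) 1 ^ 2 + (z ⨯₃ y) 2 ^ 2 =
      (z 0 ^ 2 + z 1 ^ 2 + z 2 ^ 2) * (y 0 ^ 2 + y 1 ^ 2 + y 2 ^ 2) - (z 0 * y 0 + z 1 * y 1 + z 2 * y 2) ^ 2 := by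
  simp only [cross_apply, Matrix.cons_val_zero, Matrix.cons_val_one, Matrix.cons_val_two, Matrix.head_cons,
    Matrix.tail_cons]
  ring

/-- **`ad ψ₀(σ_{λ_z})` on the `2`-vector `ω_{λ_y}⁻¹`**: `−λ_z ∘ ω_y⁻¹ − ω_y⁻¹ ∘ σ_{λ_z} = −(2|z×y|²/|y|²) ω_{z×y}⁻¹`
(from `[λ_z, λ_y] = 2λ_{z×y}` and `♯(ξ ∘ λ_z) = −λ_z ♯ξ`). [cite: LooijengaLunts1997, §4 (4.2) (proof)] -/
theorem ad_psi0_twistorBivector (h : IsLinearHyperkaehler g₀ J) {z y : Fin 3 → ℝ} (hzy : z ⨯₃ y ≠ 0) :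
    -(dualTranspose E ((ContinuousLinearMap.precomp ℝ (z 0 • opI E + z 1 • J + z 2 • opK J) :
        (E →L[ℝ] ℝ) →L[ℝ] (E →L[ℝ] ℝ)) : Module.End ℝ (E →L[ℝ] ℝ)) ∘ₗ h.twistorBivector y) -
        h.twistorBivector y ∘ₗ ((ContinuousLinearMap.precomp ℝ (z 0 • opI E + z 1 • J + z 2 • opK J) :
        (E →L[ℝ] ℝ) →L[ℝ] (E →L[ℝ] ℝ)) : Module.End ℝ (E →L[ℝ] ℝ)) =
      -((2 * ((z ⨯₃ y) 0 ^ 2 + (z ⨯₃ y) 1 ^ 2 + (z ⨯₃ y) 2 ^ 2) * (y 0 ^ 2 + y 1 ^ 2 + y 2 ^ 2)⁻¹) •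
        h.twistorBivector (z ⨯₃ y)) := by
  have hn : (z ⨯₃ y) 0 ^ 2 + (z ⨯₃ y) 1 ^ 2 + (z ⨯₃ y) 2 ^ 2 ≠ 0 := normSq_ne_zero hzy
  have hskew : ∀ v w : E, g₀ ((z 0 • opI E + z 1 • J + z 2 • opK J) v) w =
      -g₀ v ((z 0 • opI E + z 1 • J + z 2 • opK J) w) := h.inner_twistor_left (z 0) (z 1) (z 2)
  refine LinearMap.ext fun ξ ↦ ?_
  rw [LinearMap.sub_apply, LinearMap.neg_apply, LinearMap.comp_apply, LinearMap.comp_apply, dualTranspose_precomp',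
    ContinuousLinearMap.coe_coe, ContinuousLinearMap.coe_coe, ContinuousLinearMap.precomp_apply,
    twistorBivector_apply, twistorBivector_apply, h.sharp_comp_of_skew hskew, LinearMap.neg_apply,
    LinearMap.smul_apply, twistorBivector_apply, smul_neg, neg_neg, smul_smul,
    show 2 * ((z ⨯₃ y) 0 ^ 2 + (z ⨯₃ y) 1 ^ 2 + (z ⨯₃ y) 2 ^ 2) * (y 0 ^ 2 + y 1 ^ 2 + y 2 ^ 2)⁻¹ *
        ((z ⨯₃ y) 0 ^ 2 + (z ⨯₃ y) 1 ^ 2 + (z ⨯₃ y) 2 ^ 2)⁻¹ = 2 * (y 0 ^ 2 + y 1 ^ 2 + y 2 ^ 2)⁻¹ by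
      field_simp,
    map_neg, map_smul, map_neg, h.twistorOp_apply_twistorOp_apply y z, h.twistorOp_apply_twistorOp_apply z y]
  simp only [cross_apply, Matrix.cons_val_zero, Matrix.cons_val_one, Matrix.cons_val_two, Matrix.head_cons,
    Matrix.tail_cons, add_apply, smul_apply, opI_apply, opK_apply, smul_add, smul_neg, neg_add, neg_neg, sub_eq_add_neg,
    smul_smul]
  module

/-- **`[ad λ_z, Λ_y] = −(2|z×y|²/|y|²) Λ_{z×y}`** (`y ≠ 0`, `z × y ≠ 0`): the degree-`0` rotations act on the dual
Lefschetz operators of the characteristic `3`-plane as on the `2`-vectors `ω_y⁻¹`.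
[cite: LooijengaLunts1997, §4 (4.2) (proof)] [cite: Verbitsky1997HyperholomorphicSheaves, §4.2] -/
theorem lie_derivExt_twistor_lefschetzDualG_twistor [Nontrivial E] (h : IsLinearHyperkaehler g₀ J)
    {z y : Fin 3 → ℝ} (hy : y ≠ 0) (hzy : z ⨯₃ y ≠ 0) :
    ⁅derivExt E ((ContinuousLinearMap.precomp ℝ (z 0 • opI E + z 1 • J + z 2 • opK J) :
        (E →L[ℝ] ℝ) →L[ℝ] (E →L[ℝ] ℝ)) : Module.End ℝ (E →L[ℝ] ℝ)),
        lefschetzDualG (fundamentalForm g₀ (y 0 • opI E + y 1 • J + y 2 • opK J))⁆ =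
      -((2 * ((z ⨯₃ y) 0 ^ 2 + (z ⨯₃ y) 1 ^ 2 + (z ⨯₃ y) 2 ^ 2) * (y 0 ^ 2 + y 1 ^ 2 + y 2 ^ 2)⁻¹) •
        lefschetzDualG (fundamentalForm g₀ ((z ⨯₃ y) 0 • opI E + (z ⨯₃ y) 1 • J + (z ⨯₃ y) 2 • opK J))) := by
  rw [h.derivExt_precomp_twistor_eq z, h.lefschetzDualG_fundamentalForm_twistor_eq hy,
    h.lefschetzDualG_fundamentalForm_twistor_eq hzy,
    ← spinorRepLin_lie (psi0_mem_so E _) ((lowEnd_mem_so_iff _).2 (h.twistorBivector_skew y)), lie_psi0_lowEnd,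
    h.ad_psi0_twistorBivector hzy, ← map_smul (spinorRepLin E), ← map_neg (spinorRepLin E)]
  congr 1
  exact LinearMap.ext fun x ↦ Prod.ext (by simp [lowEnd_apply]) (by simp [lowEnd_apply])

/-- **`[ad λ_z, Λ_y] = −2 Λ_{z×y}` for orthonormal `z ⊥ y`** — with `[ad λ_z, L_x] = −2 L_{z×x}`,
`[ad λ_x, ad λ_y] = −2 ad λ_{x×y}`, `[L_x, Λ_y] = |y|⁻²(⟨x,y⟩ h + ad λ_{x×y})`, `[L, L] = [Λ, Λ] = [h, ad] = 0`,
`[h, L] = 2L`, `[h, Λ] = −2Λ` this completes the multiplication table of the span of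
`L_I, L_J, L_K, Λ_I, Λ_J, Λ_K, ad I, ad J, ad K, h` (Verbitsky's basis of `𝔞 ≅ 𝔰𝔬(4,1)`).
[cite: Verbitsky1997HyperholomorphicSheaves, §4.2 ("It has the following basis: L_R, Λ_R, ad R (R = I,J,K) and … H")]
[cite: LooijengaLunts1997, §4 (4.2)] -/
theorem lie_derivExt_twistor_lefschetzDualG_twistor_of_orthonormal [Nontrivial E] (h : IsLinearHyperkaehler g₀ J)
    {z y : Fin 3 → ℝ} (hz : z 0 ^ 2 + z 1 ^ 2 + z 2 ^ 2 = 1) (hy : y 0 ^ 2 + y 1 ^ 2 + y 2 ^ 2 = 1)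
    (hzy : z 0 * y 0 + z 1 * y 1 + z 2 * y 2 = 0) :
    ⁅derivExt E ((ContinuousLinearMap.precomp ℝ (z 0 • opI E + z 1 • J + z 2 • opK J) :
        (E →L[ℝ] ℝ) →L[ℝ] (E →L[ℝ] ℝ)) : Module.End ℝ (E →L[ℝ] ℝ)),
        lefschetzDualG (fundamentalForm g₀ (y 0 • opI E + y 1 • J + y 2 • opK J))⁆ =
      -((2 : ℝ) • lefschetzDualG (fundamentalForm g₀ ((z ⨯₃ y) 0 • opI E + (z ⨯₃ y) 1 • J + (z ⨯₃ y) 2 • opK J))) := by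
  have hn : (z ⨯₃ y) 0 ^ 2 + (z ⨯₃ y) 1 ^ 2 + (z ⨯₃ y) 2 ^ 2 = 1 := by rw [normSq_cross, hz, hy, hzy]; ring
  have hy0 : y ≠ 0 := by
    rintro rfl
    simp at hy
  have hzy0 : z ⨯₃ y ≠ 0 := by
    intro h0
    rw [h0] at hn
    simp at hn
  rw [h.lie_derivExt_twistor_lefschetzDualG_twistor hy0 hzy0, hn, hy, inv_one, mul_one, mul_one]

end IsLinearHyperkaehler

end Literature.Geometry.Hyperkaehler

end
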